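import Mathlib.GroupTheory.SpecificGroups.Cyclic
import Mathlib.GroupTheory.Finiteness
import Mathlib.GroupTheory.QuotientGroup.Basic
import Mathlib.GroupTheory.Subgroup.Centralizer
import Mathlib.RingTheory.Ideal.Operations
import Mathlib.RingTheory.Finiteness.Defs
import Mathlib.LinearAlgebra.Matrix.Determinant.Basic
import Literature.Topology.FourManifolds.AlexanderModule
import HarnessLib

/-!
# The trivializer on the Alexander ideal: `Δ(1) = ±1` for finitely generated groups

This file proves the purely algebraic core of the classical theorem `Δ_K(1) = ±1` for the
Alexander polynomial of a knot (Crowell–Fox, *Introduction to Knot Theory*, Ch. IX (1.1)–(1.2)),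
in the intrinsic language of `Literature.Topology.FourManifolds.AlexanderModule`
(`Literature.alexanderModule G = G'/G''` over `ℤ[Gᵃᵇ]`, `Literature.alexanderIdeal G` its `0`-th Fitting ideal,
`Literature.IsAlexanderPolynomial G Δ`).

## Main statements

* `Literature.Topology.FourManifolds.alexanderModule.mk`: the class in the Alexander module of an element of `G'`.
* `Literature.alexanderModule.comap S`: the normal subgroup `{g ∈ G' | [g] ∈ S}` of `G` attached to a
  `ℤ[Gᵃᵇ]`-submodule `S` of the Alexander module.
* `Literature.Topology.FourManifolds.alexanderModule.finite`: if `G` is finitely generated then `G'/G''` is a finitely generated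
  `ℤ[Gᵃᵇ]`-module (generated by the classes of the commutators of the generators).
* `Literature.Topology.FourManifolds.alexanderModule.ker_smul_top_eq_top`: if `Gᵃᵇ` is cyclic then `𝔞 • (G'/G'') = G'/G''` for the
  augmentation ideal `𝔞 = ker ε` of any *trivializer* `ε : ℤ[Gᵃᵇ] →+* R` (`ε g = 1` for `g ∈ Gᵃᵇ`);
  group-theoretically: `G' = [G, G']` when `G/G'` is cyclic.
* `Literature.Topology.FourManifolds.Module.exists_mem_fittingIdeal_map_eq_one`: the determinant trick — if `A` is generated by
  finitely many elements and `(ker ε) • A = A` then some element of the `0`-th Fitting ideal of `A`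
  is mapped to `1` by `ε`.
* `Literature.Topology.FourManifolds.IsAlexanderPolynomial.isUnit_eval_one_of_fg`: **Crowell–Fox Ch. IX (1.2)/(1.1)** — for a
  finitely generated group `G`, every Alexander polynomial `Δ` of `G` satisfies `Δ(1) = ±1`
  (`IsUnit (Δ(1))` in `ℤ`).

## Source and proof

R. H. Crowell, R. H. Fox, *Introduction to Knot Theory* (Ginn 1963; Springer GTM 57, 1977),
Ch. IX §1: (1.1) `|Δ_k(1)| = 1` for any knot group; (1.2) for any finite presentation of a knot
group the trivializer `t` maps the elementary ideal `E_k`, `k ≥ 1`, onto `ℤ`. Their proof only uses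
that the group is finitely presented with infinite cyclic abelianization. Here the Fitting ideal is
defined intrinsically (determinants of square relation matrices of finite generating families), so
the proof is re-organised: (i) `G` f.g. ⇒ `G'/G''` f.g. over `ℤ[Gᵃᵇ]`; (ii) `Gᵃᵇ` cyclic ⇒
`G' = [G, G']` (a central-by-cyclic group is abelian, Mathlib's
`MonoidHom.isMulCommutative_of_isCyclic_of_ker_le_center`) ⇒ `𝔞 • (G'/G'') = G'/G''`; (iii) writing each generator
`xᵢ = ∑ cᵢⱼ xⱼ` with `cᵢⱼ ∈ 𝔞` gives the relation matrix `1 - c` whose determinant lies in the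
Fitting ideal and trivializes to `det 1 = 1`; (iv) transporting along `ℤ[Gᵃᵇ] ≃ ℤ[t, t⁻¹]` and
evaluating at `t = 1`, `1 = q(1) Δ(1)`. Finite generation is essential: with the intrinsic Fitting
ideal (`⊥` for a non-finitely-generated module) the statement fails for arbitrary groups with
`Gᵃᵇ ≃ ℤ`.

Mathlib has all the group theory used (`commutator`, `Abelianization`, `QuotientGroup.lift`,
`MonoidHom.isMulCommutative_of_isCyclic_of_ker_le_center`, `Subgroup.isMulCommutative_closure`, `Group.FG`,
`Submodule.mem_ideal_smul_span_iff_exists_sum`, `RingHom.map_det`, `LaurentPolynomial.eval₂`);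
it has no Alexander module (see `AlexanderModule`).
-/

noncomputable section

open scoped LaurentPolynomial commutatorElement

namespace Literature.Topology.FourManifolds

/-! ## The determinant trick for the `0`-th Fitting ideal -/

section Fitting

variable {R : Type*} [CommRing R] {A : Type*} [AddCommGroup A] [Module R A] {R' : Type*}
  [CommRing R']

/-- **Determinant trick.** If `A` is generated by a finite family `x` and `𝔞 • A = A` for the
kernel `𝔞` of a ring homomorphism `ε : R →+* R'`, then some element `d` of the `0`-th Fitting ideal
of `A` satisfies `ε d = 1`: write `xᵢ = ∑ⱼ cᵢⱼ • xⱼ` with `cᵢⱼ ∈ 𝔞`; the square relation matrix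
`1 - c` has `ε (det (1 - c)) = det 1 = 1`. (Cf. Eisenbud, *Commutative Algebra*, Cor. 4.7 /
Prop. 20.7; Crowell–Fox Ch. IX §1.) [folklore] -/
theorem Module.exists_mem_fittingIdeal_map_eq_one {n : ℕ} (x : Fin n → A)
    (hx : Submodule.span R (Set.range x) = ⊤) (ε : R →+* R')
    (hε : RingHom.ker ε • (⊤ : Submodule R A) = ⊤) :
    ∃ d ∈ Module.fittingIdeal R A, ε d = 1 := by
  classical
  have hmem : ∀ i, ∃ c : Fin n → R, (∀ j, c j ∈ RingHom.ker ε) ∧ ∑ j, c j • x j = x i := by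
    intro i
    have hi : x i ∈ RingHom.ker ε • Submodule.span R (Set.range x) := by
      rw [hx, hε]; exact Submodule.mem_top
    obtain ⟨a, ha, hax⟩ := (Submodule.mem_ideal_smul_span_iff_exists_sum _ x (x i)).1 hi
    refine ⟨a, ha, ?_⟩
    rw [← hax, Finsupp.sum_fintype]
    intro j; exact zero_smul _ _
  choose c hcε hcx using hmem
  let a : Matrix (Fin n) (Fin n) R := 1 - Matrix.of c
  refine ⟨a.det, Ideal.subset_span ⟨n, x, a, hx, fun i => ?_, rfl⟩, ?_⟩
  · simp only [a, Matrix.sub_apply, Matrix.one_apply, Matrix.of_apply, sub_smul, ite_smul, one_smul,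
      zero_smul, Finset.sum_sub_distrib, Finset.sum_ite_eq, Finset.mem_univ, if_true, hcx i,
      sub_self]
  · have ha : ε.mapMatrix a = 1 := by
      ext i j
      have hij : ε (c i j) = 0 := hcε i j
      simp [a, Matrix.one_apply, hij]
    rw [RingHom.map_det, ha, Matrix.det_one]

end Fitting

/-! ## Classes in the Alexander module and the subgroup attached to a submodule -/

section Group

variable {G : Type*} [Group G]

/-- The class `[h] ∈ G'/G''` in the Alexander module of an element `h` of the commutator subgroup
`G'` (through Mathlib's `Representation.asModuleEquiv`). Crowell–Fox Ch. VIII §3. [folklore] -/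
def alexanderModule.mk (h : commutator G) : alexanderModule G :=
  (alexanderRep G).asModuleEquiv.symm (Additive.ofMul (Abelianization.of h))

/-- The class map `G' → G'/G''` is multiplicative-to-additive. [folklore] -/
@[simp]
theorem alexanderModule.mk_mul (h k : commutator G) :
    alexanderModule.mk (h * k) = alexanderModule.mk h + alexanderModule.mk k := by
  simp [alexanderModule.mk]

/-- The class of `1 ∈ G'` is `0`. [folklore] -/
@[simp]
theorem alexanderModule.mk_one : alexanderModule.mk (1 : commutator G) = 0 := by
  simp [alexanderModule.mk]

/-- The class of an inverse is the negative. [folklore] -/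
@[simp]
theorem alexanderModule.mk_inv (h : commutator G) :
    alexanderModule.mk h⁻¹ = -alexanderModule.mk h := by
  simp [alexanderModule.mk]

/-- The group-ring element of `g ∈ G` acts on `[h]` by conjugation: `ḡ • [h] = [g h g⁻¹]`. [folklore] -/
theorem alexanderModule.of_smul_mk (g : G) (h : commutator G) :
    MonoidAlgebra.of ℤ (Abelianization G) (Abelianization.of g) • alexanderModule.mk h =
      alexanderModule.mk (MulAut.conjNormal g h) := by
  rw [alexanderModule.mk, alexanderModule.mk, ← Representation.asModuleEquiv_symm_map_rho,
    alexanderRep_of_apply_ofMul_of]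

/-- Every element of the Alexander module is the class of an element of `G'`. [folklore] -/
theorem alexanderModule.mk_surjective :
    Function.Surjective (alexanderModule.mk : commutator G → alexanderModule G) := by
  intro m
  obtain ⟨h, hh⟩ := QuotientGroup.mk_surjective (Additive.toMul ((alexanderRep G).asModuleEquiv m))
  refine ⟨h, ?_⟩
  rw [alexanderModule.mk, LinearEquiv.symm_apply_eq]
  change Additive.ofMul (QuotientGroup.mk h : Abelianization (commutator G)) = _
  rw [hh, ofMul_toMul]

/-- The subgroup `{g ∈ G' | [g] ∈ S}` of `G` attached to a `ℤ[Gᵃᵇ]`-submodule `S` of the Alexander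
module `G'/G''`; it is normal (`S` is stable under the conjugation action) and lies between `G''`
and `G'`. Standard dictionary submodules ↔ normal subgroups (Crowell–Fox Ch. VIII §3). [folklore] -/
def alexanderModule.comap (S : Submodule (MonoidAlgebra ℤ (Abelianization G)) (alexanderModule G)) :
    Subgroup G where
  carrier := {g | ∃ hg : g ∈ commutator G, alexanderModule.mk ⟨g, hg⟩ ∈ S}
  one_mem' := ⟨one_mem _, by
    change alexanderModule.mk (1 : commutator G) ∈ S
    rw [alexanderModule.mk_one]; exact S.zero_mem⟩
  mul_mem' := by
    rintro a b ⟨ha, haS⟩ ⟨hb, hbS⟩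
    refine ⟨mul_mem ha hb, ?_⟩
    have : alexanderModule.mk (⟨a, ha⟩ * ⟨b, hb⟩ : commutator G) ∈ S := by
      rw [alexanderModule.mk_mul]; exact S.add_mem haS hbS
    exact this
  inv_mem' := by
    rintro a ⟨ha, haS⟩
    refine ⟨inv_mem ha, ?_⟩
    have : alexanderModule.mk (⟨a, ha⟩⁻¹ : commutator G) ∈ S := by
      rw [alexanderModule.mk_inv]; exact S.neg_mem haS
    exact this

/-- Membership in the subgroup attached to a submodule (definitional unfolding). [folklore] -/
theorem alexanderModule.mem_comap_iff {S : Submodule (MonoidAlgebra ℤ (Abelianization G))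
    (alexanderModule G)} {g : G} :
    g ∈ alexanderModule.comap S ↔ ∃ hg : g ∈ commutator G, alexanderModule.mk ⟨g, hg⟩ ∈ S :=
  Iff.rfl

/-- An element of `G'` lying in the subgroup attached to `S` has its class in `S`. [folklore] -/
theorem alexanderModule.mk_mem_of_mem_comap {S : Submodule (MonoidAlgebra ℤ (Abelianization G))
    (alexanderModule G)} {h : commutator G} (hh : (h : G) ∈ alexanderModule.comap S) :
    alexanderModule.mk h ∈ S := by
  obtain ⟨_, h'⟩ := hh
  exact h'

/-- The subgroup attached to a submodule of `G'/G''` is contained in `G'`. [folklore] -/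
theorem alexanderModule.comap_le (S : Submodule (MonoidAlgebra ℤ (Abelianization G))
    (alexanderModule G)) : alexanderModule.comap S ≤ commutator G :=
  fun _ ⟨hg, _⟩ => hg

/-- The subgroup attached to a submodule of the Alexander module is normal. [folklore] -/
instance alexanderModule.normal_comap (S : Submodule (MonoidAlgebra ℤ (Abelianization G))
    (alexanderModule G)) : (alexanderModule.comap S).Normal := by
  refine ⟨fun g ⟨hg, hgS⟩ k => ⟨(inferInstance : (commutator G).Normal).conj_mem g hg k, ?_⟩⟩
  have := S.smul_mem (MonoidAlgebra.of ℤ (Abelianization G) (Abelianization.of k)) hgS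
  have hk : MulAut.conjNormal k (⟨g, hg⟩ : commutator G) =
      ⟨k * g * k⁻¹, (inferInstance : (commutator G).Normal).conj_mem g hg k⟩ :=
    Subtype.ext (MulAut.conjNormal_apply k _)
  rw [alexanderModule.of_smul_mk, hk] at this
  exact this

/-- A submodule of the Alexander module whose attached subgroup contains `G'` is everything. [folklore] -/
theorem alexanderModule.eq_top_of_commutator_le_comap
    {S : Submodule (MonoidAlgebra ℤ (Abelianization G)) (alexanderModule G)}
    (h : commutator G ≤ alexanderModule.comap S) : S = ⊤ := by
  rw [eq_top_iff]
  rintro m -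
  obtain ⟨g, rfl⟩ := alexanderModule.mk_surjective m
  exact alexanderModule.mk_mem_of_mem_comap (h g.2)

/-- If `G` is generated by a set `T` whose pairwise commutators lie in a normal subgroup `N`, then
`G' ≤ N` (the quotient `G ⧸ N` is generated by pairwise commuting elements). [folklore] -/
theorem commutator_le_of_closure_eq_top {T : Set G} (hT : Subgroup.closure T = ⊤)
    (N : Subgroup G) [N.Normal] (h : ∀ s ∈ T, ∀ t ∈ T, ⁅s, t⁆ ∈ N) : commutator G ≤ N := by
  have hk : Subgroup.closure ((QuotientGroup.mk' N) '' T) = ⊤ := by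
    rw [← MonoidHom.map_closure, hT, Subgroup.map_top_of_surjective _ (QuotientGroup.mk'_surjective N)]
  have hcomm : ∀ x ∈ (QuotientGroup.mk' N) '' T, ∀ y ∈ (QuotientGroup.mk' N) '' T, x * y = y * x := by
    rintro _ ⟨s, hs, rfl⟩ _ ⟨t, ht, rfl⟩
    have h1 : (QuotientGroup.mk' N ⁅s, t⁆) = 1 := (QuotientGroup.eq_one_iff _).2 (h s hs t ht)
    rw [map_commutatorElement, commutatorElement_eq_one_iff_commute] at h1
    exact h1.eq
  have hc : ∀ x y : G ⧸ N, Commute x y := by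
    intro x y
    have hx : x ∈ Subgroup.closure ((QuotientGroup.mk' N) '' T) := by rw [hk]; exact Subgroup.mem_top _
    have hy : y ∈ Subgroup.closure ((QuotientGroup.mk' N) '' T) := by rw [hk]; exact Subgroup.mem_top _
    have := (Subgroup.isMulCommutative_closure hcomm).is_comm.comm
      (⟨x, hx⟩ : Subgroup.closure ((QuotientGroup.mk' N) '' T)) ⟨y, hy⟩
    exact congrArg Subtype.val this
  rw [commutator_def, Subgroup.commutator_le]
  rintro a - b -
  rw [← QuotientGroup.eq_one_iff, ← QuotientGroup.mk'_apply, map_commutatorElement,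
    commutatorElement_eq_one_iff_commute]
  exact hc _ _

/-- If `Gᵃᵇ` is cyclic and `N ≤ G'` is a normal subgroup containing `[G, G']`, then `G' ≤ N`, i.e.
**`G' = [G, G']` for groups with cyclic abelianization**: `G ⧸ N` is a central extension of the
cyclic group `Gᵃᵇ` by `G'/N`, hence abelian (Mathlib's `MonoidHom.isMulCommutative_of_isCyclic_of_ker_le_center`).
[folklore] -/
theorem commutator_le_of_isCyclic_abelianization [IsCyclic (Abelianization G)] (N : Subgroup G)
    [N.Normal] (hN : N ≤ commutator G) (h : ∀ g : G, ∀ c ∈ commutator G, ⁅g, c⁆ ∈ N) :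
    commutator G ≤ N := by
  let f : G ⧸ N →* Abelianization G :=
    QuotientGroup.lift N Abelianization.of fun x hx =>
      (QuotientGroup.eq_one_iff x).2 (hN hx)
  have hf : f.ker ≤ Subgroup.center (G ⧸ N) := by
    intro x hx
    obtain ⟨g, rfl⟩ := QuotientGroup.mk_surjective x
    have hg : g ∈ commutator G := by
      rw [MonoidHom.mem_ker] at hx
      change Abelianization.of g = 1 at hx
      exact (QuotientGroup.eq_one_iff g).1 hx
    rw [Subgroup.mem_center_iff]
    intro y
    obtain ⟨k, rfl⟩ := QuotientGroup.mk_surjective y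
    have h1 : ((⁅k, g⁆ : G) : G ⧸ N) = 1 := (QuotientGroup.eq_one_iff _).2 (h k g hg)
    rw [← QuotientGroup.mk'_apply, map_commutatorElement, commutatorElement_eq_one_iff_commute] at h1
    exact h1.eq
  have hc := (f.isMulCommutative_of_isCyclic_of_ker_le_center hf).is_comm.comm
  rw [commutator_def, Subgroup.commutator_le]
  rintro a - b -
  rw [← QuotientGroup.eq_one_iff, ← QuotientGroup.mk'_apply, map_commutatorElement,
    commutatorElement_eq_one_iff_commute]
  exact hc _ _

/-! ## Finite generation of the Alexander module -/

/-- **A finitely generated group has finitely generated Alexander module**: if `G` is generated by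
a finite set `T`, then `G'/G''` is generated over `ℤ[Gᵃᵇ]` by the classes of the commutators
`⁅s, t⁆`, `s, t ∈ T` (`G'` is the normal closure of these commutators, and the `ℤ[Gᵃᵇ]`-span is
stable under conjugation). Crowell–Fox Ch. VIII §3 (finitely presented case). [folklore] -/
instance alexanderModule.finite [Group.FG G] :
    Module.Finite (MonoidAlgebra ℤ (Abelianization G)) (alexanderModule G) := by
  obtain ⟨T, hT, hTfin⟩ := Group.fg_iff.1 ‹Group.FG G›
  let x : T × T → alexanderModule G := fun p =>
    alexanderModule.mk ⟨⁅(p.1 : G), (p.2 : G)⁆,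
      Subgroup.commutator_mem_commutator (Subgroup.mem_top _) (Subgroup.mem_top _)⟩
  haveI : Finite T := hTfin.to_subtype
  refine ⟨⟨(Set.range x).toFinite.toFinset, ?_⟩⟩
  rw [Set.Finite.coe_toFinset]
  apply alexanderModule.eq_top_of_commutator_le_comap
  refine commutator_le_of_closure_eq_top hT _ fun s hs t ht =>
    ⟨Subgroup.commutator_mem_commutator (Subgroup.mem_top _) (Subgroup.mem_top _), ?_⟩
  exact Submodule.subset_span ⟨(⟨s, hs⟩, ⟨t, ht⟩), rfl⟩

/-! ## The augmentation ideal acts surjectively when `Gᵃᵇ` is cyclic -/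

/-- If `Gᵃᵇ` is cyclic and `ε : ℤ[Gᵃᵇ] →+* R` is a *trivializer* (`ε ḡ = 1` for every group
element), then `(ker ε) • (G'/G'') = G'/G''`: the class of `⁅g, c⁆` (`c ∈ G'`) is `(ḡ - 1) • [c]`,
so the subgroup attached to `(ker ε) • ⊤` contains `[G, G'] = G'`
(`commutator_le_of_isCyclic_abelianization`). This is the module form of Crowell–Fox Ch. IX (1.2)
("`t ∂[xᵢ, xⱼ]/∂xₖ = 0`"). [folklore] -/
theorem alexanderModule.ker_smul_top_eq_top [IsCyclic (Abelianization G)] {R : Type*} [CommRing R]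
    (ε : MonoidAlgebra ℤ (Abelianization G) →+* R)
    (hε : ∀ a : Abelianization G, ε (MonoidAlgebra.of ℤ (Abelianization G) a) = 1) :
    RingHom.ker ε • (⊤ : Submodule (MonoidAlgebra ℤ (Abelianization G)) (alexanderModule G)) = ⊤ := by
  apply alexanderModule.eq_top_of_commutator_le_comap
  refine commutator_le_of_isCyclic_abelianization _ (alexanderModule.comap_le _) fun g c hc => ?_
  have hgc : ⁅g, c⁆ ∈ commutator G := by
    rw [commutatorElement_def]
    exact mul_mem ((inferInstance : (commutator G).Normal).conj_mem c hc g) (inv_mem hc)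
  refine ⟨hgc, ?_⟩
  have key : alexanderModule.mk ⟨⁅g, c⁆, hgc⟩ =
      (MonoidAlgebra.of ℤ (Abelianization G) (Abelianization.of g) - 1) •
        alexanderModule.mk ⟨c, hc⟩ := by
    rw [sub_smul, one_smul, alexanderModule.of_smul_mk, sub_eq_add_neg, ← alexanderModule.mk_inv,
      ← alexanderModule.mk_mul]
    congr 1
  rw [key]
  refine Submodule.smul_mem_smul ?_ Submodule.mem_top
  rw [RingHom.mem_ker, map_sub, hε, map_one, sub_self]

/-! ## `Δ(1) = ±1` -/

/-- The trivializer `ℤ[Gᵃᵇ] ≃ ℤ[t, t⁻¹] → ℤ`, `t ↦ 1`, sends every group element to `1`. [folklore] -/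
theorem eval₂_one_laurentEquivOfMulEquiv_of (e : Abelianization G ≃* Multiplicative ℤ)
    (a : Abelianization G) :
    LaurentPolynomial.eval₂ (RingHom.id ℤ) 1
      (laurentEquivOfMulEquiv G e (MonoidAlgebra.of ℤ (Abelianization G) a)) = 1 := by
  rw [MonoidAlgebra.of_apply, laurentEquivOfMulEquiv_single, LaurentPolynomial.eval₂_C_mul_T,
    one_zpow, Units.val_one, mul_one, RingHom.id_apply]

/-- **`Δ(1) = ±1` (Crowell–Fox Ch. IX (1.1)–(1.2)).** For a finitely generated group `G` (in
particular a knot group), every Alexander polynomial `Δ` of `G` in the sense of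
`Literature.Topology.FourManifolds.IsAlexanderPolynomial` evaluates at `t = 1` to a unit of `ℤ`. Crowell–Fox state (1.2) for
finite presentations of knot groups; the proof uses only finite generation and `Gᵃᵇ ≃ ℤ` (which
is part of `IsAlexanderPolynomial`). Real proof (determinant trick + `G' = [G, G']`).
[cite: CrowellFox1963, Ch. IX (1.1)–(1.2)] -/
theorem IsAlexanderPolynomial.isUnit_eval_one_of_fg [Group.FG G] {Δ : ℤ[T;T⁻¹]}
    (h : IsAlexanderPolynomial G Δ) : IsUnit (LaurentPolynomial.eval₂ (RingHom.id ℤ) 1 Δ) := by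
  obtain ⟨e, he⟩ := h
  haveI : IsCyclic (Abelianization G) := isCyclic_of_surjective e.symm e.symm.surjective
  let ε : MonoidAlgebra ℤ (Abelianization G) →+* ℤ :=
    (LaurentPolynomial.eval₂ (RingHom.id ℤ) 1).comp (laurentEquivOfMulEquiv G e).toRingHom
  have hε : ∀ a, ε (MonoidAlgebra.of ℤ (Abelianization G) a) = 1 :=
    eval₂_one_laurentEquivOfMulEquiv_of e
  have htop := alexanderModule.ker_smul_top_eq_top ε hε
  obtain ⟨n, x, hx⟩ :=
    Module.Finite.exists_fin (R := MonoidAlgebra ℤ (Abelianization G)) (M := alexanderModule G)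
  obtain ⟨d, hd, hεd⟩ := Module.exists_mem_fittingIdeal_map_eq_one x hx ε htop
  have hd' : laurentEquivOfMulEquiv G e d ∈ Ideal.span {Δ} := by
    rw [← he]
    exact Ideal.mem_map_of_mem _ hd
  obtain ⟨q, hq⟩ := Ideal.mem_span_singleton'.1 hd'
  have h1 : LaurentPolynomial.eval₂ (RingHom.id ℤ) 1 q * LaurentPolynomial.eval₂ (RingHom.id ℤ) 1 Δ
      = 1 := by
    rw [← map_mul, hq]
    exact hεd
  exact IsUnit.of_mul_eq_one_right _ h1

end Group

end Literature.Topology.FourManifolds
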